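import Literature.Probability.RandomPlanarGeometry.LoewnerPointCocycle
import Literature.Probability.RandomPlanarGeometry.LoewnerAdaptedPlane
import Literature.Probability.Process.PathRegularization
import HarnessLib

/-!
# The event "Rohde–Schramm's ratio reaches a level before the swallowing time" is measurable

Topic `Probability/RandomPlanarGeometry`; theorems and two auxiliary definitions. For a family of
continuous driving functions `U ω : ℝ≥0 → ℝ` indexed by a measurable space `(Ω, 𝓜)` with
`ω ↦ U ω s` measurable for every `s`, a point `x` of the open upper half-plane and a level `Λ`,
we prove that

* `Loewner.reachAt U x Λ t = {ω | t < T_x(U ω) ∧ Λ ≤ ψₜ(x)[U ω]}` is measurable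
  (`measurableSet_reachAt`): on the measurable event `{t < T_x}`
  (`Loewner.measurableSet_lt_swallowingTime_of_im_pos`) the derivative `gₜ'(x)` is the limit of the
  difference quotients `(gₜ(x + 1/(n+1)) - gₜ(x))(n+1)` of the measurable flow
  (`Loewner.measurable_map_of_im_pos`, `Loewner.hasDerivAt_map_deriv`), so that
  `ψₜ(x) = (Im x)|gₜ'(x)|/Im gₜ(x)` is a pointwise limit of measurable functions there;
* `Loewner.reach U x Λ = {ω | ∃ t < T_x(U ω), Λ ≤ ψₜ(x)[U ω]}` is measurable
  (`measurableSet_reach`): by monotonicity of `t ↦ ψₜ(x)` on `[0, T_x)` (Rohde–Schramm (2005),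
  eq. (6.3), `Loewner.derivRatio_mono`) rational times suffice (`reach_eq_iUnion_reachAt`);
* the **joint measurability in the starting point and the path**
  (`measurableSet_reach_normDriving_prod`): for the family of regularised raw paths scaled by a
  constant `c`, `V_w = c · pathRegularize w` (`Literature.Probability.Process.pathRegularize`;
  for `c = √κ` this is the universal SLE_κ driving path `pathDriving κ w` of `RadialBesselMarkov`),
  the set `{(x, w) | Im x > 0, ∃ t < T_x(V_w), Λ ≤ ψₜ(x)[V_w]}` is measurable in
  `ℂ × (ℝ≥0 → ℝ)`: by the normalisation to the point `i`
  (`Loewner.exists_reach_iff_normDriving`) it is the preimage of the event at the fixed point `i`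
  under the measurable map `(x, w) ↦ normDriving x V_w`.

These are the measurability inputs of the strong Markov property of the SLE_κ point functionals
(restart at a stopping time from the frozen random point `z_T`, `BrownianStrongMarkov`), used for
the one-point estimate of Rohde–Schramm (2005), Lemma 6.3 / Beffara (2008), Prop. 4.

## References

* S. Rohde, O. Schramm, *Basic properties of SLE*, Ann. of Math. 161 (2005), §2.1, §3 (p. 896:
  measurability with respect to `σ(ξ(s), s ≤ t)`), Lemma 6.3 and eq. (6.3).
* D. Revuz, M. Yor, *Continuous Martingales and Brownian Motion* (1999), Ch. I §4.
-/

noncomputable section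

open Set Filter Topology Complex MeasureTheory
open UpperHalfPlane (upperHalfPlaneSet isOpen_upperHalfPlaneSet)
open scoped NNReal

namespace Literature.Probability.RandomPlanarGeometry

namespace Loewner

variable {Ω : Type*} {mΩ : MeasurableSpace Ω} {U : Ω → ℝ≥0 → ℝ} {x : ℂ}

/-! ### The events -/

variable (U) in
/-- **The event "`t < T_x` and `ψₜ(x) ≥ Λ`"** for a family of driving functions `U ω`.
[cite: RohdeSchramm2005, Lemma 6.3] -/
def reachAt (x : ℂ) (lam : ℝ) (t : ℝ≥0) : Set Ω :=
  {ω | (t : WithTop ℝ≥0) < swallowingTime (U ω) x ∧ lam ≤ derivRatio (U ω) x t}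

variable (U) in
/-- **The event "`ψ(x)` reaches the level `Λ` before the swallowing time `T_x`"**
(`= {Z(x) ≥ Λ}` for Rohde–Schramm's `Z(x) = sup_{t < T_x} ψₜ(x)`, the ratio being non-decreasing).
[cite: RohdeSchramm2005, Lemma 6.3] -/
def reach (x : ℂ) (lam : ℝ) : Set Ω :=
  {ω | ∃ t : ℝ≥0, (t : WithTop ℝ≥0) < swallowingTime (U ω) x ∧ lam ≤ derivRatio (U ω) x t}

/-- Membership in `reachAt`. [folklore] -/
theorem mem_reachAt_iff {lam : ℝ} {t : ℝ≥0} {ω : Ω} :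
    ω ∈ reachAt U x lam t ↔
      (t : WithTop ℝ≥0) < swallowingTime (U ω) x ∧ lam ≤ derivRatio (U ω) x t := Iff.rfl

/-- Membership in `reach`. [folklore] -/
theorem mem_reach_iff {lam : ℝ} {ω : Ω} :
    ω ∈ reach U x lam ↔
      ∃ t : ℝ≥0, (t : WithTop ℝ≥0) < swallowingTime (U ω) x ∧ lam ≤ derivRatio (U ω) x t :=
  Iff.rfl

/-! ### Measurability at a fixed time: difference quotients -/

/-- The difference quotients `(gₜ(x + 1/(n+1)) - gₜ(x))(n+1)` converge to `gₜ'(x)` for `t < T_x`.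
[cite: Lawler2005, Ch. 4 §4.1] -/
theorem tendsto_slope_map_nat {W : ℝ≥0 → ℝ} (hW : Continuous W) (hx : 0 < x.im) {t : ℝ≥0}
    (ht : (t : WithTop ℝ≥0) < swallowingTime W x) :
    Tendsto (fun n : ℕ ↦ (map W t (x + ((1 / ((n : ℝ) + 1) : ℝ) : ℂ)) - map W t x) /
      ((1 / ((n : ℝ) + 1) : ℝ) : ℂ)) atTop (𝓝 (deriv (map W t) x)) := by
  have hd := hasDerivAt_iff_tendsto_slope.1 (hasDerivAt_map_deriv hW hx ht)
  have hr0 : Tendsto (fun n : ℕ ↦ (((1 / ((n : ℝ) + 1) : ℝ)) : ℂ)) atTop (𝓝 0) := by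
    have h := (Complex.continuous_ofReal.tendsto 0).comp tendsto_one_div_add_atTop_nhds_zero_nat
    rwa [Complex.ofReal_zero] at h
  have hne : ∀ n : ℕ, (((1 / ((n : ℝ) + 1) : ℝ)) : ℂ) ≠ 0 := fun n ↦
    Complex.ofReal_ne_zero.2
      (one_div_pos.2 (Nat.cast_add_one_pos n : (0 : ℝ) < (n : ℝ) + 1)).ne'
  have htend : Tendsto (fun n : ℕ ↦ x + (((1 / ((n : ℝ) + 1) : ℝ)) : ℂ)) atTop (𝓝[≠] x) := by
    refine tendsto_nhdsWithin_iff.2 ⟨?_, Eventually.of_forall fun n ↦ ?_⟩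
    · simpa using tendsto_const_nhds.add hr0
    · simpa using hne n
  refine (hd.comp htend).congr fun n ↦ ?_
  rw [Function.comp_apply, slope_def_field, add_sub_cancel_left]

/-- **`{t < T_x, ψₜ(x) ≥ Λ}` is measurable** for a family of continuous driving functions with
measurable coordinates and `Im x > 0`. [cite: RohdeSchramm2005, §2.1] -/
theorem measurableSet_reachAt (hc : ∀ ω, Continuous (U ω)) (hmeas : ∀ s, Measurable fun ω ↦ U ω s)
    (hx : 0 < x.im) (lam : ℝ) (t : ℝ≥0) : MeasurableSet (reachAt U x lam t) := by
  have hmeas' : ∀ s, s ≤ t → Measurable fun ω ↦ U ω s := fun s _ ↦ hmeas s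
  have hG : MeasurableSet {ω | (t : WithTop ℝ≥0) < swallowingTime (U ω) x} :=
    measurableSet_lt_swallowingTime_of_im_pos hc hmeas' hx
  -- the difference quotients and the approximate ratios
  set r : ℕ → ℝ := fun n ↦ 1 / ((n : ℝ) + 1) with hr
  have hxn : ∀ n, 0 < (x + ((r n : ℝ) : ℂ)).im := fun n ↦ by simpa using hx
  set D : ℕ → Ω → ℂ := fun n ω ↦ (map (U ω) t (x + ((r n : ℝ) : ℂ)) - map (U ω) t x) / ((r n : ℝ) : ℂ)
    with hD
  have hDm : ∀ n, Measurable (D n) := fun n ↦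
    ((measurable_map_of_im_pos hc hmeas' (hxn n)).sub (measurable_map_of_im_pos hc hmeas' hx)).div_const _
  set Q : ℕ → Ω → ℝ := fun n ω ↦ x.im * ‖D n ω‖ / (map (U ω) t x).im with hQ
  have hQm : ∀ n, Measurable (Q n) := fun n ↦
    (measurable_const.mul (hDm n).norm).div
      (Complex.measurable_im.comp (measurable_map_of_im_pos hc hmeas' hx))
  -- on `{t < T_x}` the approximate ratios converge to `ψₜ(x)`
  have hlim : ∀ ω, (t : WithTop ℝ≥0) < swallowingTime (U ω) x →
      Tendsto (fun n ↦ Q n ω) atTop (𝓝 (derivRatio (U ω) x t)) := by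
    intro ω hω
    have h3 : Tendsto (fun n ↦ D n ω) atTop (𝓝 (deriv (map (U ω) t) x)) :=
      tendsto_slope_map_nat (hc ω) hx hω
    have h4 := ((continuous_norm.tendsto _).comp h3).const_mul x.im
    rw [derivRatio_apply]
    exact h4.div_const _
  -- countable description of `{Λ ≤ lim Q n}` on the convergence set
  have hset : reachAt U x lam t = {ω | (t : WithTop ℝ≥0) < swallowingTime (U ω) x} ∩
      ⋂ k : ℕ, ⋃ N : ℕ, ⋂ n : ℕ, {ω | N ≤ n → lam - 1 / ((k : ℝ) + 1) ≤ Q n ω} := by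
    ext ω
    simp only [reachAt, mem_setOf_eq, mem_inter_iff, mem_iInter, mem_iUnion]
    constructor
    · rintro ⟨hω, hle⟩
      refine ⟨hω, fun k ↦ ?_⟩
      have hlt : lam - 1 / ((k : ℝ) + 1) < derivRatio (U ω) x t := by
        have hk : (0 : ℝ) < 1 / ((k : ℝ) + 1) := one_div_pos.2 (Nat.cast_add_one_pos k)
        linarith
      obtain ⟨N, hN⟩ := eventually_atTop.1 ((hlim ω hω).eventually (lt_mem_nhds hlt))
      exact ⟨N, fun n hn ↦ (hN n hn).le⟩
    · rintro ⟨hω, h⟩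
      refine ⟨hω, ?_⟩
      have hk : ∀ k : ℕ, lam - 1 / ((k : ℝ) + 1) ≤ derivRatio (U ω) x t := fun k ↦ by
        obtain ⟨N, hN⟩ := h k
        exact ge_of_tendsto (hlim ω hω) (eventually_atTop.2 ⟨N, fun n hn ↦ hN n hn⟩)
      have hl : Tendsto (fun k : ℕ ↦ lam - 1 / ((k : ℝ) + 1)) atTop (𝓝 (lam - 0)) :=
        tendsto_const_nhds.sub tendsto_one_div_add_atTop_nhds_zero_nat
      rw [sub_zero] at hl
      exact le_of_tendsto' hl hk
  rw [hset]
  refine hG.inter (MeasurableSet.iInter fun k ↦ MeasurableSet.iUnion fun N ↦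
    MeasurableSet.iInter fun n ↦ ?_)
  exact (MeasurableSet.const _).imp (measurableSet_le measurable_const (hQm n))

/-! ### Rational times suffice -/

/-- **`{∃ t < T_x, ψₜ(x) ≥ Λ} = ⋃_{q ∈ ℚ} {q⁺ < T_x, ψ_{q⁺}(x) ≥ Λ}`**: `ψ(x)` is non-decreasing on
`[0, T_x)` (eq. (6.3)) and `[t, T_x)` contains a rational. [cite: RohdeSchramm2005, eq. (6.3)] -/
theorem reach_eq_iUnion_reachAt (hc : ∀ ω, Continuous (U ω)) (hx : 0 < x.im) (lam : ℝ) :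
    reach U x lam = ⋃ q : ℚ, reachAt U x lam ((q : ℝ).toNNReal) := by
  ext ω
  simp only [reach, reachAt, mem_setOf_eq, mem_iUnion]
  constructor
  · rintro ⟨t, ht, hle⟩
    -- a rational time `q` with `t ≤ q⁺ < T_x`
    obtain ⟨q, htq, hqT⟩ : ∃ q : ℚ, t ≤ (q : ℝ).toNNReal ∧
        (((q : ℝ).toNNReal : ℝ≥0) : WithTop ℝ≥0) < swallowingTime (U ω) x := by
      rcases eq_top_or_lt_top (swallowingTime (U ω) x) with htop | hfin
      · obtain ⟨q, hq⟩ := exists_rat_gt (t : ℝ)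
        refine ⟨q, ?_, by rw [htop]; exact WithTop.coe_lt_top _⟩
        rw [← NNReal.coe_le_coe, Real.coe_toNNReal _ (t.coe_nonneg.trans hq.le)]
        exact hq.le
      · obtain ⟨b, hb⟩ := WithTop.ne_top_iff_exists.1 hfin.ne
        rw [← hb] at ht ⊢
        have htb : (t : ℝ) < b := by exact_mod_cast WithTop.coe_lt_coe.1 ht
        obtain ⟨q, htq, hqb⟩ := exists_rat_btwn htb
        have hq0 : 0 ≤ (q : ℝ) := t.coe_nonneg.trans htq.le
        refine ⟨q, ?_, ?_⟩
        · rw [← NNReal.coe_le_coe, Real.coe_toNNReal _ hq0]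
          exact htq.le
        · rw [WithTop.coe_lt_coe, ← NNReal.coe_lt_coe, Real.coe_toNNReal _ hq0]
          exact hqb
    exact ⟨q, hqT, hle.trans (derivRatio_mono (hc ω) hx htq hqT)⟩
  · rintro ⟨q, hq, hle⟩
    exact ⟨_, hq, hle⟩

/-- **`{∃ t < T_x, ψₜ(x) ≥ Λ}` is measurable** for a family of continuous driving functions with
measurable coordinates and `Im x > 0`. [cite: RohdeSchramm2005, §2.1] -/
theorem measurableSet_reach (hc : ∀ ω, Continuous (U ω)) (hmeas : ∀ s, Measurable fun ω ↦ U ω s)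
    (hx : 0 < x.im) (lam : ℝ) : MeasurableSet (reach U x lam) := by
  rw [reach_eq_iUnion_reachAt hc hx lam]
  exact MeasurableSet.iUnion fun q ↦ measurableSet_reachAt hc hmeas hx lam _

/-! ### Joint measurability in the starting point and the raw path -/

section Joint

open Literature.Probability.Process

/-- **The scaled regularised raw path** `c · pathRegularize w` (continuous for every raw path
`w : ℝ≥0 → ℝ`, equal to `c w` for continuous `w`; for `c = √κ` the universal SLE_κ driving path).
[folklore] -/
def scaledPath (c : ℝ) (w : ℝ≥0 → ℝ) : ℝ≥0 → ℝ := fun s ↦ c * pathRegularize w s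

/-- Unfolding lemma. [folklore] -/
theorem scaledPath_apply (c : ℝ) (w : ℝ≥0 → ℝ) (s : ℝ≥0) :
    scaledPath c w s = c * pathRegularize w s := rfl

/-- The scaled regularised paths are continuous. [folklore] -/
theorem continuous_scaledPath (c : ℝ) (w : ℝ≥0 → ℝ) : Continuous (scaledPath c w) :=
  continuous_const.mul (continuous_pathRegularize w)

/-- The regularisation of a continuous path is the path. [folklore] -/
theorem pathRegularize_eq_of_continuous {v : ℝ≥0 → ℝ} (hv : Continuous v) : pathRegularize v = v :=
  pathRegularize_eq_self_of_continuous hv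

/-- The map `(x, w) ↦ normDriving x (scaledPath c w)` into the path space is measurable (the
regularised path is jointly measurable in `(w, time)`, `measurable_uncurry_pathRegularize`).
[folklore] -/
theorem measurable_normDriving_scaledPath (c : ℝ) :
    Measurable fun p : ℂ × (ℝ≥0 → ℝ) ↦ normDriving p.1 (scaledPath c p.2) := by
  refine measurable_pi_lambda _ fun s ↦ ?_
  simp only [normDriving_apply, scaledPath_apply]
  have hf : Measurable fun p : ℂ × (ℝ≥0 → ℝ) ↦ p.1.im.toNNReal ^ 2 * s :=
    ((Complex.measurable_im.comp measurable_fst).real_toNNReal.pow_const 2).mul_const s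
  have hreg : Measurable fun p : ℂ × (ℝ≥0 → ℝ) ↦ pathRegularize p.2 (p.1.im.toNNReal ^ 2 * s) :=
    measurable_uncurry_pathRegularize.comp (measurable_snd.prodMk hf)
  exact ((measurable_const.mul hreg).sub (Complex.measurable_re.comp measurable_fst)).div
    (Complex.measurable_im.comp measurable_fst)

/-- **Joint measurability of the reach event in the starting point and the raw path**: the set
of pairs `(x, w)` with `Im x > 0` such that `ψ(x)` for the driving function `c · pathRegularize w`
reaches `Λ` before `T_x` is measurable in `ℂ × (ℝ≥0 → ℝ)` (product σ-algebra on paths).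
[cite: RohdeSchramm2005, §2.1] -/
theorem measurableSet_reach_scaledPath_prod (c lam : ℝ) :
    MeasurableSet {p : ℂ × (ℝ≥0 → ℝ) | 0 < p.1.im ∧
      ∃ t : ℝ≥0, (t : WithTop ℝ≥0) < swallowingTime (scaledPath c p.2) p.1 ∧
        lam ≤ derivRatio (scaledPath c p.2) p.1 t} := by
  -- the event at the fixed point `i` for the family of regularised paths
  set S₀ : Set (ℝ≥0 → ℝ) := reach (fun v : ℝ≥0 → ℝ ↦ pathRegularize v) I lam with hS₀
  have hS₀ : MeasurableSet S₀ :=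
    measurableSet_reach (fun v ↦ continuous_pathRegularize v) measurable_pathRegularize
      (by simp) lam
  have hset : {p : ℂ × (ℝ≥0 → ℝ) | 0 < p.1.im ∧
      ∃ t : ℝ≥0, (t : WithTop ℝ≥0) < swallowingTime (scaledPath c p.2) p.1 ∧
        lam ≤ derivRatio (scaledPath c p.2) p.1 t} =
      {p : ℂ × (ℝ≥0 → ℝ) | 0 < p.1.im} ∩
        (fun p : ℂ × (ℝ≥0 → ℝ) ↦ normDriving p.1 (scaledPath c p.2)) ⁻¹' S₀ := by
    ext p
    simp only [mem_setOf_eq, mem_inter_iff, mem_preimage]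
    refine ⟨fun h ↦ ⟨h.1, ?_⟩, fun h ↦ ⟨h.1, ?_⟩⟩
    · have h2 := (exists_reach_iff_normDriving (continuous_scaledPath c p.2) h.1 lam).1 h.2
      change _ ∈ reach _ I lam
      rw [mem_reach_iff, pathRegularize_eq_of_continuous
        (continuous_normDriving p.1 (continuous_scaledPath c p.2))]
      exact h2
    · have h2 : normDriving p.1 (scaledPath c p.2) ∈ reach (fun v : ℝ≥0 → ℝ ↦ pathRegularize v) I lam :=
        h.2
      rw [mem_reach_iff, pathRegularize_eq_of_continuous
        (continuous_normDriving p.1 (continuous_scaledPath c p.2))] at h2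
      exact (exists_reach_iff_normDriving (continuous_scaledPath c p.2) h.1 lam).2 h2
  rw [hset]
  exact (measurableSet_lt measurable_const (Complex.measurable_im.comp measurable_fst)).inter
    (hS₀.preimage (measurable_normDriving_scaledPath c))

end Joint

end Loewner

end Literature.Probability.RandomPlanarGeometry
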